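import Summits.Ventures.PercRepro.CoreFourNullity
import Summits.Ventures.PercRepro.CoreFourTriangles
import Summits.Ventures.PercRepro.RankLevelSetCorankFour

/-!
# PercRepro — the counts of the corank-`4` core cell (p2, gen 12)

On the coloop-free core at corank `4` (`n := |E| ≥ 13`), with `s₃`, `s₄` the numbers of `3`- and `4`-element circuits
and `S₀ = ⋃ {circuits with ≤ 4 elements}`:

* `ncard_five_sets_le` — the `5`-sets of rank `≤ 3` number at most `s₄·(|S₀| − 4)` (each is a `4`-circuit plus a point
  of `S₀` outside it: `CoreFourTriangles` and `CoreFourNullity`);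
* `ncard_four_sets_le` — the `4`-sets of rank `≤ 3` number at most `s₃·(n − 3) + s₄` (a `4`-circuit, or a triangle plus
  one of the `n − 3` points OUTSIDE it — the `n − 3` is what the cell `n = 15` needs);
* `topCount_le` — `#U(p,3) ≤ C(n,3) + s₃·(n − 3) + s₄` (after night-1's `topCount_le_corank_four`);
* **`ncard_eRk_le_three_le`** — `#{r ≤ 3} ≤ Σ_{j≤3} C(n,j) + (s₃(n−3) + s₄) + s₄·(|S₀| − 4) + 1`
  (sizes `≤ 3`, `4`, `5`, and the at most one `6`-set; no set of rank `≤ 3` has `≥ 7` points).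
Imports `CoreFourNullity`, `CoreFourTriangles`, `RankLevelSetCorankFour`. Axioms: standard.
-/

namespace PercRepro
namespace CoreFour

open Set

variable {α : Type} {M : Matroid α}

/-! ### The counts -/

/-- `S₀ = ⋃ {circuits with ≤ 4 elements}` lies in `E`. -/
theorem sUnion_circuitsLE_subset_ground (M : Matroid α) (k : ℕ) :
    ⋃₀ PercRepro.Matroid.circuitsLE M k ⊆ M.E := by
  intro x hx
  obtain ⟨C, hC, hxC⟩ := Set.mem_sUnion.1 hx
  exact PercRepro.Matroid.subset_ground_of_mem_circuitsLE hC hxC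

/-- A `4`-element circuit lies in `S₀ = ⋃ {circuits with ≤ 4 elements}`. -/
theorem subset_sUnion_of_mem_circuitsEq_four [M.Finite] {C : Set α}
    (hC : C ∈ PercRepro.Matroid.circuitsEq M 4) : C ⊆ ⋃₀ PercRepro.Matroid.circuitsLE M 4 :=
  Set.subset_sUnion_of_mem (PercRepro.Matroid.circuitsEq_subset_circuitsLE le_rfl hC)

/-- **The `5`-sets of rank `≤ 3` number at most `s₄·(|S₀| − 4)`** on the core: each is a `4`-circuit plus a point of
`S₀` outside it. -/
theorem ncard_five_sets_le [M.Finite] (hs : ∀ e ∈ M.E, ∀ f ∈ M.E, e ≠ f → M.eRk {e, f} = 2)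
    (hC1 : ∀ L ⊆ M.E, M.eRk L = 2 → L.ncard ≤ 3) :
    {X : Set α | X ⊆ M.E ∧ X.ncard = 5 ∧ M.eRk X ≤ 3}.ncard ≤
      (PercRepro.Matroid.circuitsEq M 4).ncard * ((⋃₀ PercRepro.Matroid.circuitsLE M 4).ncard - 4) := by
  classical
  set S₀ := ⋃₀ PercRepro.Matroid.circuitsLE M 4 with hS₀
  have hS₀E : S₀ ⊆ M.E := sUnion_circuitsLE_subset_ground M 4
  have hS₀fin : S₀.Finite := M.ground_finite.subset hS₀E
  have h𝒞fin : (PercRepro.Matroid.circuitsEq M 4).Finite := PercRepro.Matroid.circuitsEq_finite 4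
  set F := h𝒞fin.toFinset with hF
  let g : Set α → Finset (Set α) := fun C =>
    (hS₀fin.subset (sdiff_subset : S₀ \ C ⊆ S₀)).toFinset.image (fun z => insert z C)
  have hcover : {X : Set α | X ⊆ M.E ∧ X.ncard = 5 ∧ M.eRk X ≤ 3} ⊆ ↑(F.biUnion g) := by
    rintro X ⟨hXE, hX5, hXr⟩
    obtain ⟨C, hCX, hC, hC4⟩ := exists_isCircuit_four_of_five hs hC1 hXE hX5 hXr
    have hXS₀ : X ⊆ S₀ := subset_sUnion_of_five_le hs hC1 hXE hXr (by omega)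
    have hXfin : X.Finite := M.ground_finite.subset hXE
    have hCfin : C.Finite := hXfin.subset hCX
    have h1 : (X \ C).ncard = 1 := by rw [Set.ncard_sdiff hCX hCfin, hX5, hC4]
    obtain ⟨z, hz⟩ := Set.ncard_eq_one.1 h1
    have hzXC : z ∈ X \ C := by rw [hz]; exact Set.mem_singleton z
    have hXeq : X = insert z C := by
      rw [← Set.union_sdiff_cancel hCX, hz, Set.union_singleton]
    rw [Finset.mem_coe, Finset.mem_biUnion]
    refine ⟨C, ?_, ?_⟩
    · rw [hF, Set.Finite.mem_toFinset]; exact ⟨hC, hC4⟩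
    · simp only [g, Finset.mem_image, Set.Finite.mem_toFinset]
      exact ⟨z, ⟨hXS₀ hzXC.1, hzXC.2⟩, hXeq.symm⟩
  have hg : ∀ C ∈ F, (g C).card ≤ S₀.ncard - 4 := by
    intro C hC
    rw [hF, Set.Finite.mem_toFinset] at hC
    have hCS₀ : C ⊆ S₀ := subset_sUnion_of_mem_circuitsEq_four hC
    have hCfin : C.Finite := hS₀fin.subset hCS₀
    calc (g C).card ≤ (hS₀fin.subset (sdiff_subset : S₀ \ C ⊆ S₀)).toFinset.card := Finset.card_image_le
      _ = (S₀ \ C).ncard := (Set.ncard_eq_toFinset_card _ _).symm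
      _ = S₀.ncard - 4 := by rw [Set.ncard_sdiff hCS₀ hCfin, hC.2]
  calc {X : Set α | X ⊆ M.E ∧ X.ncard = 5 ∧ M.eRk X ≤ 3}.ncard
      ≤ (↑(F.biUnion g) : Set (Set α)).ncard := Set.ncard_le_ncard hcover (Finset.finite_toSet _)
    _ = (F.biUnion g).card := Set.ncard_coe_finset _
    _ ≤ ∑ C ∈ F, (g C).card := Finset.card_biUnion_le
    _ ≤ ∑ _C ∈ F, (S₀.ncard - 4) := Finset.sum_le_sum hg
    _ = F.card * (S₀.ncard - 4) := by rw [Finset.sum_const, smul_eq_mul]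
    _ = (PercRepro.Matroid.circuitsEq M 4).ncard * (S₀.ncard - 4) := by
        rw [hF, ← Set.ncard_eq_toFinset_card _ h𝒞fin]

/-- **The `4`-sets of rank `≤ 3` number at most `s₃·(n − 3) + s₄`**: each is a `4`-circuit or a triangle plus one of
the `n − 3` points outside it (the sharpening of `ncard_four_sets_eRk_le_three` by `3·s₃`). -/
theorem ncard_four_sets_le [M.Finite] (hs : ∀ e ∈ M.E, ∀ f ∈ M.E, e ≠ f → M.eRk {e, f} = 2)
    (hrank : 2 ≤ M.eRank) :
    {X : Set α | X ⊆ M.E ∧ X.ncard = 4 ∧ M.eRk X ≤ 3}.ncard ≤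
      (PercRepro.Matroid.circuitsEq M 3).ncard * (M.E.ncard - 3) + (PercRepro.Matroid.circuitsEq M 4).ncard := by
  classical
  have hEfin : M.E.Finite := M.ground_finite
  have h3fin : (PercRepro.Matroid.circuitsEq M 3).Finite := PercRepro.Matroid.circuitsEq_finite 3
  have h4fin : (PercRepro.Matroid.circuitsEq M 4).Finite := PercRepro.Matroid.circuitsEq_finite 4
  set F₃ := h3fin.toFinset with hF₃
  set F₄ := h4fin.toFinset with hF₄
  let g : Set α → Finset (Set α) := fun C =>
    (hEfin.subset (sdiff_subset : M.E \ C ⊆ M.E)).toFinset.image (fun z => insert z C)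
  have hcover : {X : Set α | X ⊆ M.E ∧ X.ncard = 4 ∧ M.eRk X ≤ 3} ⊆ ↑(F₃.biUnion g ∪ F₄) := by
    rintro X ⟨hXE, hX4, hXr⟩
    have hXfin : X.Finite := hEfin.subset hXE
    have hdep : M.Dep X := dep_of_eRk_lt_ncard hXE (by rw [hX4]; exact lt_of_le_of_lt hXr (by norm_num))
    obtain ⟨C, hCX, hC⟩ := hdep.exists_isCircuit_subset
    have hCfin : C.Finite := hXfin.subset hCX
    have h3 := three_le_ncard_of_isCircuit hs hrank hC
    have h4 : C.ncard ≤ 4 := by rw [← hX4]; exact Set.ncard_le_ncard hCX hXfin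
    rw [Finset.mem_coe, Finset.mem_union]
    rcases Nat.lt_or_ge C.ncard 4 with hlt | hge
    · -- a triangle plus a point
      have hC3 : C.ncard = 3 := by omega
      have h1 : (X \ C).ncard = 1 := by rw [Set.ncard_sdiff hCX hCfin, hX4, hC3]
      obtain ⟨z, hz⟩ := Set.ncard_eq_one.1 h1
      have hzXC : z ∈ X \ C := by rw [hz]; exact Set.mem_singleton z
      have hXeq : X = insert z C := by
        rw [← Set.union_sdiff_cancel hCX, hz, Set.union_singleton]
      left
      rw [Finset.mem_biUnion]
      refine ⟨C, ?_, ?_⟩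
      · rw [hF₃, Set.Finite.mem_toFinset]; exact ⟨hC, hC3⟩
      · simp only [g, Finset.mem_image, Set.Finite.mem_toFinset]
        exact ⟨z, ⟨hXE hzXC.1, hzXC.2⟩, hXeq.symm⟩
    · -- a `4`-circuit
      have hCX' : C = X := Set.eq_of_subset_of_ncard_le hCX (by omega) hXfin
      right
      rw [hF₄, Set.Finite.mem_toFinset]
      exact ⟨hCX' ▸ hC, hX4⟩
  have hg : ∀ C ∈ F₃, (g C).card ≤ M.E.ncard - 3 := by
    intro C hC
    rw [hF₃, Set.Finite.mem_toFinset] at hC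
    have hCE : C ⊆ M.E := hC.1.subset_ground
    have hCfin : C.Finite := hEfin.subset hCE
    calc (g C).card ≤ (hEfin.subset (sdiff_subset : M.E \ C ⊆ M.E)).toFinset.card := Finset.card_image_le
      _ = (M.E \ C).ncard := (Set.ncard_eq_toFinset_card _ _).symm
      _ = M.E.ncard - 3 := by rw [Set.ncard_sdiff hCE hCfin, hC.2]
  calc {X : Set α | X ⊆ M.E ∧ X.ncard = 4 ∧ M.eRk X ≤ 3}.ncard
      ≤ (↑(F₃.biUnion g ∪ F₄) : Set (Set α)).ncard := Set.ncard_le_ncard hcover (Finset.finite_toSet _)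
    _ = (F₃.biUnion g ∪ F₄).card := Set.ncard_coe_finset _
    _ ≤ (F₃.biUnion g).card + F₄.card := Finset.card_union_le _ _
    _ ≤ (∑ C ∈ F₃, (g C).card) + F₄.card := by gcongr; exact Finset.card_biUnion_le
    _ ≤ (∑ _C ∈ F₃, (M.E.ncard - 3)) + F₄.card := Nat.add_le_add_right (Finset.sum_le_sum hg) _
    _ = F₃.card * (M.E.ncard - 3) + F₄.card := by rw [Finset.sum_const, smul_eq_mul]
    _ = _ := by rw [hF₃, hF₄, ← Set.ncard_eq_toFinset_card _ h3fin, ← Set.ncard_eq_toFinset_card _ h4fin]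

/-- **`#U(p,3) ≤ C(n,3) + s₃·(n − 3) + s₄`** at corank `4` (after night-1's `topCount_le_corank_four`: the rank-`3`
side of a `U`-partition is coindependent, hence has `3` or `4` elements). -/
theorem topCount_le [M.Finite] (hs : ∀ e ∈ M.E, ∀ f ∈ M.E, e ≠ f → M.eRk {e, f} = 2)
    (hrank : 2 ≤ M.eRank) {p : ℕ} (hd : M.E.encard = M.eRank + 4) (hR : M.eRank = (p : ℕ∞)) :
    Matroid.topCount M p 3 ≤ M.E.ncard.choose 3 +
      ((PercRepro.Matroid.circuitsEq M 3).ncard * (M.E.ncard - 3) + (PercRepro.Matroid.circuitsEq M 4).ncard) := by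
  classical
  have hE : (M.ground_finite.toFinset : Set α) = M.E := Set.Finite.coe_toFinset _
  have hinj : Set.InjOn (fun A : Set α => M.E \ A)
      {A : Set α | A ⊆ M.E ∧ M.eRk A = (p : ℕ∞) ∧ M.eRk (M.E \ A) = ((3 : ℕ) : ℕ∞)} := by
    intro X hX Y hY hXY
    simp only at hXY
    rw [← Set.sdiff_sdiff_cancel_left hX.1, hXY, Set.sdiff_sdiff_cancel_left hY.1]
  have hmaps : ∀ A ∈ {A : Set α | A ⊆ M.E ∧ M.eRk A = (p : ℕ∞) ∧ M.eRk (M.E \ A) = ((3 : ℕ) : ℕ∞)},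
      (fun A : Set α => M.E \ A) A ∈
        {B : Set α | B ⊆ (M.ground_finite.toFinset : Set α) ∧ B.ncard = 3} ∪
        {B : Set α | B ⊆ M.E ∧ B.ncard = 4 ∧ M.eRk B ≤ 3} := by
    rintro A ⟨hAE, hAr, hBr⟩
    simp only
    have hBE : M.E \ A ⊆ M.E := Set.sdiff_subset
    have hBfin : (M.E \ A).Finite := M.ground_finite.subset hBE
    have h3 : ((3 : ℕ) : ℕ∞) ≤ (M.E \ A).encard := by rw [← hBr]; exact M.eRk_le_encard _
    have hAp : (p : ℕ∞) ≤ A.encard := by rw [← hAr]; exact M.eRk_le_encard A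
    have hsum : A.encard + (M.E \ A).encard = M.E.encard := by
      rw [add_comm]; exact Set.encard_sdiff_add_encard_of_subset hAE
    have h4 : (M.E \ A).encard ≤ 4 := by
      have h : (p : ℕ∞) + (M.E \ A).encard ≤ (p : ℕ∞) + 4 := by
        calc (p : ℕ∞) + (M.E \ A).encard ≤ A.encard + (M.E \ A).encard := by gcongr
          _ = M.E.encard := hsum
          _ = (p : ℕ∞) + 4 := by rw [hd, hR]
      exact (WithTop.add_le_add_iff_left (WithTop.natCast_ne_top p)).1 h
    rw [← hBfin.cast_ncard_eq] at h3 h4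
    have h3' : 3 ≤ (M.E \ A).ncard := by exact_mod_cast h3
    have h4' : (M.E \ A).ncard ≤ 4 := by exact_mod_cast h4
    rcases Nat.lt_or_ge (M.E \ A).ncard 4 with hlt | hge
    · exact Or.inl ⟨by rw [hE]; exact hBE, by omega⟩
    · refine Or.inr ⟨hBE, by omega, ?_⟩
      rw [hBr]; exact_mod_cast le_refl (3 : ℕ)
  have hfin : ({B : Set α | B ⊆ (M.ground_finite.toFinset : Set α) ∧ B.ncard = 3} ∪
        {B : Set α | B ⊆ M.E ∧ B.ncard = 4 ∧ M.eRk B ≤ 3}).Finite :=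
    ((M.ground_finite.toFinset.finite_toSet.finite_subsets).subset (fun X hX => hX.1)).union
      (M.ground_finite.finite_subsets.subset (fun X hX => hX.1))
  have hcard : M.ground_finite.toFinset.card = M.E.ncard := (Set.ncard_eq_toFinset_card _ _).symm
  calc Matroid.topCount M p 3
      = {A : Set α | A ⊆ M.E ∧ M.eRk A = (p : ℕ∞) ∧ M.eRk (M.E \ A) = ((3 : ℕ) : ℕ∞)}.ncard := rfl
    _ ≤ ({B : Set α | B ⊆ (M.ground_finite.toFinset : Set α) ∧ B.ncard = 3} ∪
          {B : Set α | B ⊆ M.E ∧ B.ncard = 4 ∧ M.eRk B ≤ 3}).ncard :=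
        Set.ncard_le_ncard_of_injOn _ hmaps hinj hfin
    _ ≤ {B : Set α | B ⊆ (M.ground_finite.toFinset : Set α) ∧ B.ncard = 3}.ncard +
          {B : Set α | B ⊆ M.E ∧ B.ncard = 4 ∧ M.eRk B ≤ 3}.ncard := Set.ncard_union_le _ _
    _ ≤ M.E.ncard.choose 3 +
          ((PercRepro.Matroid.circuitsEq M 3).ncard * (M.E.ncard - 3) + (PercRepro.Matroid.circuitsEq M 4).ncard) := by
        rw [ncard_subsets_ncard_eq, hcard]
        gcongr
        exact ncard_four_sets_le hs hrank

/-- **The sets of rank `≤ 3`** on the coloop-free core at corank `4` with `|E| ≥ 13`: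
`#{r ≤ 3} ≤ Σ_{j≤3} C(n,j) + (s₃(n−3) + s₄) + s₄·(|S₀| − 4) + 1`. -/
theorem ncard_eRk_le_three_le [M.Finite] (hs : ∀ e ∈ M.E, ∀ f ∈ M.E, e ≠ f → M.eRk {e, f} = 2)
    (hC1 : ∀ L ⊆ M.E, M.eRk L = 2 → L.ncard ≤ 3) (hcoloop : ∀ e, ¬ M.IsColoop e)
    (hrank : 2 ≤ M.eRank) (hd : M.E.encard = M.eRank + 4) (hn : 13 ≤ M.E.ncard) :
    {X : Set α | X ⊆ M.E ∧ M.eRk X ≤ 3}.ncard ≤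
      (∑ j ∈ Finset.range 4, M.E.ncard.choose j) +
      ((PercRepro.Matroid.circuitsEq M 3).ncard * (M.E.ncard - 3) + (PercRepro.Matroid.circuitsEq M 4).ncard) +
      (PercRepro.Matroid.circuitsEq M 4).ncard * ((⋃₀ PercRepro.Matroid.circuitsLE M 4).ncard - 4) + 1 := by
  classical
  have hE : (M.ground_finite.toFinset : Set α) = M.E := Set.Finite.coe_toFinset _
  have hcard : M.ground_finite.toFinset.card = M.E.ncard := (Set.ncard_eq_toFinset_card _ _).symm
  have hcover : {X : Set α | X ⊆ M.E ∧ M.eRk X ≤ 3} ⊆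
      (({X : Set α | X ⊆ (M.ground_finite.toFinset : Set α) ∧ X.ncard ≤ 3} ∪
        {X : Set α | X ⊆ M.E ∧ X.ncard = 4 ∧ M.eRk X ≤ 3}) ∪
        {X : Set α | X ⊆ M.E ∧ X.ncard = 5 ∧ M.eRk X ≤ 3}) ∪
        {X : Set α | X ⊆ M.E ∧ X.ncard = 6 ∧ M.eRk X ≤ 3} := by
    rintro X ⟨hXE, hXr⟩
    have h6 := ncard_le_six_of_eRk_le_three hcoloop hd (by omega) hXE hXr
    rcases Nat.lt_or_ge X.ncard 4 with h3 | h4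
    · exact Or.inl (Or.inl (Or.inl ⟨by rw [hE]; exact hXE, by omega⟩))
    rcases Nat.lt_or_ge X.ncard 5 with h4' | h5
    · exact Or.inl (Or.inl (Or.inr ⟨hXE, by omega, hXr⟩))
    rcases Nat.lt_or_ge X.ncard 6 with h5' | h6'
    · exact Or.inl (Or.inr ⟨hXE, by omega, hXr⟩)
    · exact Or.inr ⟨hXE, by omega, hXr⟩
  have hfinE := M.ground_finite.finite_subsets
  have hfin : ((({X : Set α | X ⊆ (M.ground_finite.toFinset : Set α) ∧ X.ncard ≤ 3} ∪
        {X : Set α | X ⊆ M.E ∧ X.ncard = 4 ∧ M.eRk X ≤ 3}) ∪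
        {X : Set α | X ⊆ M.E ∧ X.ncard = 5 ∧ M.eRk X ≤ 3}) ∪
        {X : Set α | X ⊆ M.E ∧ X.ncard = 6 ∧ M.eRk X ≤ 3}).Finite := by
    refine (((hfinE.subset ?_).union (hfinE.subset ?_)).union (hfinE.subset ?_)).union (hfinE.subset ?_)
    · intro X hX; rw [hE] at hX; exact hX.1
    · intro X hX; exact hX.1
    · intro X hX; exact hX.1
    · intro X hX; exact hX.1
  have h3 := ncard_subsets_ncard_le (M.ground_finite.toFinset) 3
  rw [hcard] at h3
  have h4 := ncard_four_sets_le hs hrank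
  have h5 := ncard_five_sets_le hs hC1
  have h6 := ncard_six_sets_le_one hs hC1 hcoloop hd hn
  calc {X : Set α | X ⊆ M.E ∧ M.eRk X ≤ 3}.ncard
      ≤ _ := Set.ncard_le_ncard hcover hfin
    _ ≤ ({X : Set α | X ⊆ (M.ground_finite.toFinset : Set α) ∧ X.ncard ≤ 3}.ncard +
          {X : Set α | X ⊆ M.E ∧ X.ncard = 4 ∧ M.eRk X ≤ 3}.ncard +
          {X : Set α | X ⊆ M.E ∧ X.ncard = 5 ∧ M.eRk X ≤ 3}.ncard) +
          {X : Set α | X ⊆ M.E ∧ X.ncard = 6 ∧ M.eRk X ≤ 3}.ncard := by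
        refine (Set.ncard_union_le _ _).trans ?_
        gcongr
        refine (Set.ncard_union_le _ _).trans ?_
        gcongr
        exact Set.ncard_union_le _ _
    _ ≤ _ := by gcongr

end CoreFour
end PercRepro
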